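import Literature.MathematicalPhysics.KineticTheory.BandEdgeVanHove
import Mathlib.Analysis.SpecialFunctions.ImproperIntegrals
import Mathlib.MeasureTheory.Measure.Haar.NormedSpace
import HarnessLib

/-!
# The `(x − E_max)^{-1/2}` law of the edge function at a non-degenerate one-dimensional band maximum and
# the `λ²` law of the bound-state splitting

Topic `Literature/MathematicalPhysics/KineticTheory` (definition request `defn-SeparableTwoBodyTMatrix`, part (ii):
"`g(z) = c (z − E_max)^{-1/2}(1 + o(1))` … hence … splitting `Δ(λ) ≍ λ²`", in two-sided, non-asymptotic form).

Setting of `BandEdgeVanHove.lean`: the circle `𝕋 = ℝ/2πℤ` with its Haar probability measure `dk`, a continuous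
band `E ≤ E_max` and a continuous form factor `g` with `g(p₀) ≠ 0`, `u = [g] ∈ L²(dk; ℂ)`, and the edge function
`g_E(x) = ∫ ‖g‖²/(x − E) dk = ⟪u, (x − M_E)⁻¹u⟫` of `SeparablePairBand.lean` for `x > E_max`. PROVED here:

* `integral_inv_add_mul_sq`: `∫_ℝ dt/(a + c t²) = π/√(ac)` (`a, c > 0`).
* `edgeFn_toLp_eq`: `g_E(x) = (2π)⁻¹ ∫_{(−π, π]} ‖g(p₀ + t)‖²/(x − E(p₀ + t)) dt` (Haar integral as an angle
  integral centred anywhere).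
* LOWER EDGE LAW `edgeFn_sqrt_lower`: a quadratic UPPER bound `E_max − E(p₀ + t) ≤ C t²` (`|t| < δ`) gives
  `k ≤ g_E(x) √(x − E_max)` for `0 < x − E_max ≤ a₀`, explicit `k = ‖g(p₀)‖²/(16π√C)`, `a₀ = C δ'²`.
* UPPER EDGE LAW `edgeFn_sqrt_upper`: a quadratic LOWER bound `c t² ≤ E_max − E(p₀ + t)` (`|t| < δ`) and a
  positive gap `η ≤ E_max − E` away from `p₀` give `g_E(x) √(x − E_max) ≤ K` for `0 < x − E_max ≤ 1`.
  Together: `g_E(x) ≍ (x − E_max)^{-1/2}`, the one-dimensional van Hove edge [Economou1983, §6.2.3 (6.47)].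
* THE `λ²` LAW `eigenvalue_splitting_sq`: under both, every eigenvalue `x > E_max` of `M_E + λ|u⟩⟨u|`
  (which exists and is unique for each `λ > 0` by `existsUnique_eigenvalue_above_circle`) satisfies
  `k² λ² ≤ x − E_max ≤ K² λ²` for `0 < λ < λ₀` [Economou1983, §6.2.3 eq. (6.48): `E_b → ε²π²C²`].

Not here: the exact constant of the asymptotics (`(1 + o(1))` form) and any statement about the pinned pair
band `E_K` specifically (its edge data `c, C, δ, η` are the requester's fibre analysis).

## References

* E. N. Economou, Green's Functions in Quantum Physics, 2nd ed., Springer 1983, §6.2.3 eqs. (6.46)–(6.48).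
  [cite: Economou1983, §6.2.3 eqs. (6.46)–(6.48)]
-/

noncomputable section

open MeasureTheory Filter Set

namespace Literature.MathematicalPhysics.KineticTheory.HeatConduction

namespace PinnedChainKinetic

/-! ### Two real-variable integrals -/

/-- The integrand `(a + c t²)⁻¹ = a⁻¹ (1 + (√(c/a) t)²)⁻¹`. [folklore] -/
theorem inv_add_mul_sq_eq {a c : ℝ} (ha : 0 < a) (hc : 0 < c) (t : ℝ) :
    (a + c * t ^ 2)⁻¹ = a⁻¹ * (1 + (Real.sqrt (c / a) * t) ^ 2)⁻¹ := by
  rw [mul_pow, Real.sq_sqrt (div_pos hc ha).le, ← mul_inv]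
  congr 1
  field_simp

/-- `t ↦ (a + c t²)⁻¹` is integrable on `ℝ` (`a, c > 0`). [folklore] -/
theorem integrable_inv_add_mul_sq {a c : ℝ} (ha : 0 < a) (hc : 0 < c) :
    Integrable fun t : ℝ => (a + c * t ^ 2)⁻¹ := by
  have hr : Real.sqrt (c / a) ≠ 0 := (Real.sqrt_pos.2 (div_pos hc ha)).ne'
  have h := (integrable_inv_one_add_sq.comp_mul_left' hr).const_mul a⁻¹
  refine h.congr (ae_of_all _ fun t => ?_)
  simp only
  rw [inv_add_mul_sq_eq ha hc]

/-- **`∫_ℝ dt/(a + c t²) = π/√(ac)`** (`a, c > 0`). [folklore] -/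
theorem integral_inv_add_mul_sq {a c : ℝ} (ha : 0 < a) (hc : 0 < c) :
    ∫ t : ℝ, (a + c * t ^ 2)⁻¹ = Real.pi / Real.sqrt (a * c) := by
  have hr : 0 < Real.sqrt (c / a) := Real.sqrt_pos.2 (div_pos hc ha)
  have hfun : (fun t : ℝ => (a + c * t ^ 2)⁻¹) = fun t => a⁻¹ * (1 + (Real.sqrt (c / a) * t) ^ 2)⁻¹ :=
    funext (inv_add_mul_sq_eq ha hc)
  rw [hfun, integral_const_mul, Measure.integral_comp_mul_left (fun u : ℝ => (1 + u ^ 2)⁻¹),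
    integral_univ_inv_one_add_sq, smul_eq_mul, abs_of_pos (inv_pos.2 hr), Real.sqrt_div' c ha.le,
    Real.sqrt_mul ha.le, inv_div]
  set sa := Real.sqrt a with hsa_def
  have hsa : sa ≠ 0 := (Real.sqrt_pos.2 ha).ne'
  have hsc : Real.sqrt c ≠ 0 := (Real.sqrt_pos.2 hc).ne'
  have haa : sa * sa = a := Real.mul_self_sqrt ha.le
  rw [← haa]
  field_simp

/-! ### The edge function of an `L²` class of a continuous form factor as an angle integral -/

section Edge

variable {E : 𝕋 → ℝ} {g : 𝕋 → ℂ} {p₀ : 𝕋} {Emax : ℝ}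

/-- `g_E(x) = (2π)⁻¹ ∫_{(−π, π]} ‖g(p₀ + t)‖²/(x − E(p₀ + t)) dt` for the `L²` class of a continuous `g`
(translation invariance of `dk` and `dk = dt/2π` on a period). [folklore] -/
theorem edgeFn_toLp_eq (hg : Continuous g) (E : 𝕋 → ℝ) (p₀ : 𝕋) (x : ℝ) :
    FiniteRank.edgeFn μ𝕋 E ((memLp_two_circle hg).toLp g) x =
      (2 * Real.pi)⁻¹ * ∫ t in Ioc (-Real.pi) (-Real.pi + 2 * Real.pi),
        ‖g (p₀ + (t : 𝕋))‖ ^ 2 / (x - E (p₀ + (t : 𝕋))) := by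
  rw [FiniteRank.edgeFn]
  have h1 : ∫ p, ‖((memLp_two_circle hg).toLp g) p‖ ^ 2 / (x - E p) ∂μ𝕋 =
      ∫ p, ‖g p‖ ^ 2 / (x - E p) ∂μ𝕋 :=
    integral_congr_ae (by
      filter_upwards [(memLp_two_circle hg).coeFn_toLp] with p hp
      rw [hp])
  rw [h1]
  set F : 𝕋 → ℝ := fun p => ‖g p‖ ^ 2 / (x - E p) with hF
  have h2 : ∫ q, F (p₀ + q) = ∫ p, F p := integral_add_left_eq_self F p₀
  have h3 := AddCircle.integral_preimage (2 * Real.pi) (-Real.pi) (fun q => F (p₀ + q))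
  rw [AddCircle.integral_haarAddCircle, smul_eq_mul, ← h2, ← h3]

/-- The angle integrand is continuous above the band. [folklore] -/
theorem continuous_edge_integrand (hE : Continuous E) (hg : Continuous g) (hEmax : ∀ p, E p ≤ Emax)
    (p₀ : 𝕋) {x : ℝ} (hx : Emax < x) :
    Continuous fun t : ℝ => ‖g (p₀ + (t : 𝕋))‖ ^ 2 / (x - E (p₀ + (t : 𝕋))) := by
  have hsh : Continuous fun t : ℝ => p₀ + (t : 𝕋) := continuous_const.add (AddCircle.continuous_mk' _)
  refine ((hg.comp hsh).norm.pow 2).div (continuous_const.sub (hE.comp hsh)) fun t => ?_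
  have := hEmax (p₀ + (t : 𝕋))
  exact ne_of_gt (by linarith)

/-- **LOWER EDGE LAW.** If `E_max − E(p₀ + t) ≤ C t²` for `|t| < δ` and `g(p₀) ≠ 0`, then
`k ≤ g_E(x) · √(x − E_max)` for `0 < x − E_max ≤ a₀`, with explicit `k, a₀ > 0`.
[cite: Economou1983, §6.2.3 eq. (6.47)] -/
theorem edgeFn_sqrt_lower (hE : Continuous E) (hg : Continuous g) {C δ : ℝ} (hC : 0 < C) (hδ : 0 < δ)
    (hEmax : ∀ p, E p ≤ Emax) (hup : ∀ t : ℝ, |t| < δ → Emax - E (p₀ + (t : 𝕋)) ≤ C * t ^ 2)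
    (hg0 : g p₀ ≠ 0) :
    ∃ a₀ > 0, ∃ k > 0, ∀ x, Emax < x → x - Emax ≤ a₀ →
      k ≤ FiniteRank.edgeFn μ𝕋 E ((memLp_two_circle hg).toLp g) x * Real.sqrt (x - Emax) := by
  -- radius on which ‖g‖ ≥ ‖g p₀‖/2
  have hgc : ContinuousAt (fun t : ℝ => g (p₀ + (t : 𝕋))) 0 := by
    have h1 : Continuous fun t : ℝ => p₀ + (t : 𝕋) := continuous_const.add (AddCircle.continuous_mk' _)
    exact (hg.continuousAt (x := p₀)).comp_of_eq h1.continuousAt (by simp)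
  have hpos0 : 0 < ‖g p₀‖ / 2 := by positivity
  obtain ⟨η, hη, hηg⟩ : ∃ η > 0, ∀ t : ℝ, |t| < η → ‖g p₀‖ / 2 ≤ ‖g (p₀ + (t : 𝕋))‖ := by
    obtain ⟨η, hη, h⟩ := Metric.continuousAt_iff.1 hgc (‖g p₀‖ / 2) hpos0
    refine ⟨η, hη, fun t ht => ?_⟩
    have hd : dist t 0 < η := by simpa [Real.dist_eq] using ht
    have := h hd
    simp only [QuotientAddGroup.mk_zero, add_zero, dist_eq_norm] at this
    linarith [norm_sub_norm_le (g p₀) (g (p₀ + (t : 𝕋))), norm_sub_rev (g p₀) (g (p₀ + (t : 𝕋)))]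
  set δ' := min (min δ η) Real.pi with hδ'
  have hδ'pos : 0 < δ' := lt_min (lt_min hδ hη) Real.pi_pos
  set κ := (‖g p₀‖ / 2) ^ 2 with hκ
  have hκpos : 0 < κ := by positivity
  refine ⟨C * δ' ^ 2, by positivity, (2 * Real.pi)⁻¹ * (κ / (2 * Real.sqrt C)), by positivity,
    fun x hx hxa => ?_⟩
  set a := x - Emax with ha_def
  have ha : 0 < a := sub_pos.2 hx
  set s := Real.sqrt (a / C) with hs_def
  have hs : 0 < s := Real.sqrt_pos.2 (div_pos ha hC)
  have hsδ' : s ≤ δ' := by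
    refine Real.sqrt_le_iff.2 ⟨hδ'pos.le, ?_⟩
    rw [div_le_iff₀ hC]
    linarith
  have hCs : C * s ^ 2 = a := by
    rw [hs_def, Real.sq_sqrt (div_pos ha hC).le]; field_simp
  have hssqrt : s * Real.sqrt a = a / Real.sqrt C := by
    rw [hs_def, Real.sqrt_div' a hC.le, div_mul_eq_mul_div, Real.mul_self_sqrt ha.le]
  -- pointwise lower bound on (0, s)
  have hpt : ∀ t ∈ Ioo (0 : ℝ) s, κ / (2 * a) ≤ ‖g (p₀ + (t : 𝕋))‖ ^ 2 / (x - E (p₀ + (t : 𝕋))) := by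
    intro t ht
    have htabs : |t| = t := abs_of_pos ht.1
    have hmin : δ' ≤ min δ η := min_le_left _ _
    have htδ : |t| < δ := by
      rw [htabs]; exact ht.2.trans_le (hsδ'.trans (hmin.trans (min_le_left _ _)))
    have htη : |t| < η := by
      rw [htabs]; exact ht.2.trans_le (hsδ'.trans (hmin.trans (min_le_right _ _)))
    have ht2 : C * t ^ 2 ≤ C * s ^ 2 := by
      have : t ^ 2 ≤ s ^ 2 := pow_le_pow_left₀ ht.1.le ht.2.le 2
      exact mul_le_mul_of_nonneg_left this hC.le
    have hEt : Emax - E (p₀ + (t : 𝕋)) ≤ a := by linarith [hup t htδ]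
    have hden : 0 < x - E (p₀ + (t : 𝕋)) := by linarith [hEmax (p₀ + (t : 𝕋))]
    have hden2 : x - E (p₀ + (t : 𝕋)) ≤ 2 * a := by linarith
    have hnum : κ ≤ ‖g (p₀ + (t : 𝕋))‖ ^ 2 := pow_le_pow_left₀ hpos0.le (hηg t htη) 2
    exact div_le_div₀ (hκpos.le.trans hnum) hnum hden hden2
  -- integral lower bound
  rw [edgeFn_toLp_eq hg E p₀ x]
  have hcont := continuous_edge_integrand hE hg hEmax p₀ hx
  have hint : IntegrableOn (fun t : ℝ => ‖g (p₀ + (t : 𝕋))‖ ^ 2 / (x - E (p₀ + (t : 𝕋))))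
      (Ioc (-Real.pi) (-Real.pi + 2 * Real.pi)) := hcont.integrableOn_Ioc
  have hnn : 0 ≤ᵐ[volume.restrict (Ioc (-Real.pi) (-Real.pi + 2 * Real.pi))]
      fun t : ℝ => ‖g (p₀ + (t : 𝕋))‖ ^ 2 / (x - E (p₀ + (t : 𝕋))) :=
    ae_of_all _ fun t => div_nonneg (sq_nonneg _) (by linarith [hEmax (p₀ + (t : 𝕋))])
  have hsπ : s ≤ Real.pi := hsδ'.trans (min_le_right _ _)
  have hsub : (Ioo (0 : ℝ) s) ≤ᵐ[volume] (Ioc (-Real.pi) (-Real.pi + 2 * Real.pi)) :=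
    ae_of_all _ fun t ht => ⟨by linarith [ht.1, Real.pi_pos], by linarith [ht.2]⟩
  have hsubset : Ioo (0 : ℝ) s ⊆ Ioc (-Real.pi) (-Real.pi + 2 * Real.pi) := fun t ht =>
    ⟨by linarith [ht.1, Real.pi_pos], by linarith [ht.2, Real.pi_pos]⟩
  have h1 : ∫ _ in Ioo (0 : ℝ) s, κ / (2 * a) ≤
      ∫ t in Ioo (0 : ℝ) s, ‖g (p₀ + (t : 𝕋))‖ ^ 2 / (x - E (p₀ + (t : 𝕋))) :=
    setIntegral_mono_on (integrableOn_const (by rw [Real.volume_Ioo]; exact ENNReal.ofReal_ne_top))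
      (hint.mono_set hsubset) measurableSet_Ioo hpt
  have h2 : ∫ t in Ioo (0 : ℝ) s, ‖g (p₀ + (t : 𝕋))‖ ^ 2 / (x - E (p₀ + (t : 𝕋))) ≤
      ∫ t in Ioc (-Real.pi) (-Real.pi + 2 * Real.pi), ‖g (p₀ + (t : 𝕋))‖ ^ 2 / (x - E (p₀ + (t : 𝕋))) :=
    setIntegral_mono_set hint hnn hsub
  have h3 : ∫ _ in Ioo (0 : ℝ) s, κ / (2 * a) = s * (κ / (2 * a)) := by
    rw [setIntegral_const, smul_eq_mul, Real.volume_real_Ioo, sub_zero, max_eq_left hs.le]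
  have hI : s * (κ / (2 * a)) ≤
      ∫ t in Ioc (-Real.pi) (-Real.pi + 2 * Real.pi), ‖g (p₀ + (t : 𝕋))‖ ^ 2 / (x - E (p₀ + (t : 𝕋))) :=
    h3 ▸ h1.trans h2
  calc (2 * Real.pi)⁻¹ * (κ / (2 * Real.sqrt C))
      = (2 * Real.pi)⁻¹ * (s * (κ / (2 * a))) * Real.sqrt a := by
        rw [mul_assoc, show s * (κ / (2 * a)) * Real.sqrt a = κ / (2 * a) * (s * Real.sqrt a) by ring,
          hssqrt]
        field_simp
    _ ≤ (2 * Real.pi)⁻¹ *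
          (∫ t in Ioc (-Real.pi) (-Real.pi + 2 * Real.pi), ‖g (p₀ + (t : 𝕋))‖ ^ 2 / (x - E (p₀ + (t : 𝕋)))) *
          Real.sqrt a := by gcongr

/-- **UPPER EDGE LAW.** If `c t² ≤ E_max − E(p₀ + t)` for `|t| < δ` and `η ≤ E_max − E(p₀ + t)` for
`δ ≤ |t| ≤ π` (`c, η > 0`: a strict, non-degenerate global maximum at `p₀`), then
`g_E(x) · √(x − E_max) ≤ K` for `0 < x − E_max ≤ 1`. [cite: Economou1983, §6.2.3 eq. (6.47)] -/
theorem edgeFn_sqrt_upper (hE : Continuous E) (hg : Continuous g) {c δ η : ℝ} (hc : 0 < c) (hη : 0 < η)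
    (hEmax : ∀ p, E p ≤ Emax) (hlow : ∀ t : ℝ, |t| < δ → c * t ^ 2 ≤ Emax - E (p₀ + (t : 𝕋)))
    (hfar : ∀ t : ℝ, δ ≤ |t| → |t| ≤ Real.pi → η ≤ Emax - E (p₀ + (t : 𝕋))) :
    ∃ K, ∀ x, Emax < x → x - Emax ≤ 1 →
      FiniteRank.edgeFn μ𝕋 E ((memLp_two_circle hg).toLp g) x * Real.sqrt (x - Emax) ≤ K := by
  obtain ⟨G, hG⟩ := isCompact_univ.exists_bound_of_continuousOn hg.continuousOn
  have hG' : ∀ p, ‖g p‖ ≤ G := fun p => hG p (mem_univ p)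
  have hG0 : 0 ≤ G := (norm_nonneg _).trans (hG' p₀)
  refine ⟨(2 * Real.pi)⁻¹ * (G ^ 2 * (Real.pi / Real.sqrt c + 2 * Real.pi / η)), fun x hx hx1 => ?_⟩
  set a := x - Emax with ha_def
  have ha : 0 < a := sub_pos.2 hx
  -- pointwise bound on a period
  have hpt : ∀ t ∈ Ioc (-Real.pi) (-Real.pi + 2 * Real.pi),
      ‖g (p₀ + (t : 𝕋))‖ ^ 2 / (x - E (p₀ + (t : 𝕋))) ≤ G ^ 2 * ((a + c * t ^ 2)⁻¹ + η⁻¹) := by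
    intro t ht
    have htπ : |t| ≤ Real.pi := abs_le.2 ⟨ht.1.le, by linarith [ht.2]⟩
    have hnum : ‖g (p₀ + (t : 𝕋))‖ ^ 2 ≤ G ^ 2 := pow_le_pow_left₀ (norm_nonneg _) (hG' _) 2
    have hq : 0 < a + c * t ^ 2 := by positivity
    rcases lt_or_ge |t| δ with h | h
    · have h1 : a + c * t ^ 2 ≤ x - E (p₀ + (t : 𝕋)) := by linarith [hlow t h]
      calc ‖g (p₀ + (t : 𝕋))‖ ^ 2 / (x - E (p₀ + (t : 𝕋))) ≤ G ^ 2 / (a + c * t ^ 2) :=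
            div_le_div₀ (by positivity) hnum hq h1
        _ = G ^ 2 * (a + c * t ^ 2)⁻¹ := div_eq_mul_inv _ _
        _ ≤ G ^ 2 * ((a + c * t ^ 2)⁻¹ + η⁻¹) := by
            gcongr; exact le_add_of_nonneg_right (inv_nonneg.2 hη.le)
    · have h1 : η ≤ x - E (p₀ + (t : 𝕋)) := by linarith [hfar t h htπ]
      calc ‖g (p₀ + (t : 𝕋))‖ ^ 2 / (x - E (p₀ + (t : 𝕋))) ≤ G ^ 2 / η := div_le_div₀ (by positivity) hnum hη h1
        _ = G ^ 2 * η⁻¹ := div_eq_mul_inv _ _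
        _ ≤ G ^ 2 * ((a + c * t ^ 2)⁻¹ + η⁻¹) := by
            gcongr; exact le_add_of_nonneg_left (inv_nonneg.2 hq.le)
  rw [edgeFn_toLp_eq hg E p₀ x]
  have hint : IntegrableOn (fun t : ℝ => ‖g (p₀ + (t : 𝕋))‖ ^ 2 / (x - E (p₀ + (t : 𝕋))))
      (Ioc (-Real.pi) (-Real.pi + 2 * Real.pi)) := (continuous_edge_integrand hE hg hEmax p₀ hx).integrableOn_Ioc
  have hI1 : Integrable fun t : ℝ => (a + c * t ^ 2)⁻¹ := integrable_inv_add_mul_sq ha hc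
  have hbint : IntegrableOn (fun t : ℝ => G ^ 2 * ((a + c * t ^ 2)⁻¹ + η⁻¹))
      (Ioc (-Real.pi) (-Real.pi + 2 * Real.pi)) :=
    ((hI1.integrableOn).add (integrableOn_const (by rw [Real.volume_Ioc]; exact ENNReal.ofReal_ne_top))).const_mul _
  have h1 : ∫ t in Ioc (-Real.pi) (-Real.pi + 2 * Real.pi), ‖g (p₀ + (t : 𝕋))‖ ^ 2 / (x - E (p₀ + (t : 𝕋))) ≤
      ∫ t in Ioc (-Real.pi) (-Real.pi + 2 * Real.pi), G ^ 2 * ((a + c * t ^ 2)⁻¹ + η⁻¹) :=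
    setIntegral_mono_on hint hbint measurableSet_Ioc hpt
  have h2 : ∫ t in Ioc (-Real.pi) (-Real.pi + 2 * Real.pi), G ^ 2 * ((a + c * t ^ 2)⁻¹ + η⁻¹) ≤
      G ^ 2 * (Real.pi / Real.sqrt (a * c) + 2 * Real.pi / η) := by
    rw [integral_const_mul]
    refine mul_le_mul_of_nonneg_left ?_ (by positivity)
    rw [integral_add hI1.integrableOn (integrableOn_const (by rw [Real.volume_Ioc]; exact ENNReal.ofReal_ne_top)),
      ← integral_inv_add_mul_sq ha hc]
    refine add_le_add (setIntegral_le_integral hI1 (ae_of_all _ fun t => inv_nonneg.2 (by positivity))) ?_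
    rw [setIntegral_const, smul_eq_mul, Real.volume_real_Ioc,
      show -Real.pi + 2 * Real.pi - -Real.pi = 2 * Real.pi by ring, max_eq_left (by positivity), div_eq_mul_inv]
  have hsa : Real.sqrt a ≤ 1 := Real.sqrt_le_one.2 hx1
  have hsa0 : 0 < Real.sqrt a := Real.sqrt_pos.2 ha
  have h3 : (Real.pi / Real.sqrt (a * c) + 2 * Real.pi / η) * Real.sqrt a ≤
      Real.pi / Real.sqrt c + 2 * Real.pi / η := by
    rw [add_mul, Real.sqrt_mul ha.le]
    refine add_le_add (le_of_eq ?_) ?_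
    · field_simp
    · calc 2 * Real.pi / η * Real.sqrt a ≤ 2 * Real.pi / η * 1 := by gcongr
        _ = 2 * Real.pi / η := mul_one _
  calc (2 * Real.pi)⁻¹ *
        (∫ t in Ioc (-Real.pi) (-Real.pi + 2 * Real.pi), ‖g (p₀ + (t : 𝕋))‖ ^ 2 / (x - E (p₀ + (t : 𝕋)))) *
        Real.sqrt a
      ≤ (2 * Real.pi)⁻¹ * (G ^ 2 * (Real.pi / Real.sqrt (a * c) + 2 * Real.pi / η)) * Real.sqrt a := by
        gcongr; exact h1.trans h2
    _ = (2 * Real.pi)⁻¹ * G ^ 2 * ((Real.pi / Real.sqrt (a * c) + 2 * Real.pi / η) * Real.sqrt a) := by ring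
    _ ≤ (2 * Real.pi)⁻¹ * G ^ 2 * (Real.pi / Real.sqrt c + 2 * Real.pi / η) := by gcongr
    _ = (2 * Real.pi)⁻¹ * (G ^ 2 * (Real.pi / Real.sqrt c + 2 * Real.pi / η)) := by ring

/-- Eigenvalue of `M_E + λ|u⟩⟨u|` at `x > E_max` iff `λ g_E(x) = 1` (rank-one W–A criterion + the integral
formula; re-exported from the proof of `existsUnique_eigenvalue_above`). [cite: Economou1983, §6.1 eq. (6.9)] -/
theorem hasEigenvector_circle_iff (hE : Continuous E) (hg : Continuous g) (hEmax : ∀ p, E p ≤ Emax)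
    (lam : ℝ) {x : ℝ} (hx : Emax < x) :
    (∃ ψ : Lp ℂ 2 μ𝕋, ψ ≠ 0 ∧
      FiniteRank.perturb₁ (FiniteRank.bandOp μ𝕋 E) (lam : ℂ) ((memLp_two_circle hg).toLp g)
        ((memLp_two_circle hg).toLp g) ψ = (x : ℂ) • ψ) ↔
      lam * FiniteRank.edgeFn μ𝕋 E ((memLp_two_circle hg).toLp g) x = 1 := by
  obtain ⟨B, hB⟩ := isCompact_univ.exists_bound_of_continuousOn hE.continuousOn
  have hB' : ∀ p, |E p| ≤ B := fun p => by simpa [Real.norm_eq_abs] using hB p (mem_univ p)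
  have hz := (FiniteRank.resolvent_bandOp (m := μ𝕋) hE.measurable hB' (sub_pos.2 hx)
    (FiniteRank.dist_le_of_above hEmax hx)).1
  rw [FiniteRank.hasEigenvector_perturb₁_iff hz, FiniteRank.inner_resolvent_bandOp_self hE.measurable hB' hEmax hx,
    ← Complex.ofReal_mul, ← Complex.ofReal_one, Complex.ofReal_inj]

/-- **THE `λ²` LAW OF THE SPLITTING.** On the circle, for a continuous band with a strict, quadratically
non-degenerate maximum `E_max` at `p₀` (`c t² ≤ E_max − E(p₀ + t) ≤ C t²` for `|t| < δ`, gap `η` beyond) and a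
continuous form factor with `g(p₀) ≠ 0`: there are `λ₀, k₁, k₂ > 0` such that for `0 < λ < λ₀` EVERY
eigenvalue `x > E_max` of `M_E + λ|g⟩⟨g|` (there is exactly one, `existsUnique_eigenvalue_above_circle`)
satisfies `k₁ λ² ≤ x − E_max ≤ k₂ λ²`. [cite: Economou1983, §6.2.3 eq. (6.48)] -/
theorem eigenvalue_splitting_sq (hE : Continuous E) (hg : Continuous g) {c C δ η : ℝ} (hc : 0 < c)
    (hC : 0 < C) (hδ : 0 < δ) (hη : 0 < η) (hEmax : ∀ p, E p ≤ Emax)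
    (hlow : ∀ t : ℝ, |t| < δ → c * t ^ 2 ≤ Emax - E (p₀ + (t : 𝕋)))
    (hup : ∀ t : ℝ, |t| < δ → Emax - E (p₀ + (t : 𝕋)) ≤ C * t ^ 2)
    (hfar : ∀ t : ℝ, δ ≤ |t| → |t| ≤ Real.pi → η ≤ Emax - E (p₀ + (t : 𝕋))) (hg0 : g p₀ ≠ 0) :
    ∃ lam₀ > 0, ∃ k₁ > 0, ∃ k₂ > 0, ∀ lam : ℝ, 0 < lam → lam < lam₀ → ∀ x : ℝ, Emax < x →
      (∃ ψ : Lp ℂ 2 μ𝕋, ψ ≠ 0 ∧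
        FiniteRank.perturb₁ (FiniteRank.bandOp μ𝕋 E) (lam : ℂ) ((memLp_two_circle hg).toLp g)
          ((memLp_two_circle hg).toLp g) ψ = (x : ℂ) • ψ) →
      k₁ * lam ^ 2 ≤ x - Emax ∧ x - Emax ≤ k₂ * lam ^ 2 := by
  obtain ⟨a₀, ha₀, k, hk, hlowb⟩ := edgeFn_sqrt_lower hE hg hC hδ hEmax hup hg0
  obtain ⟨K, hupb⟩ := edgeFn_sqrt_upper hE hg hc hη hEmax hlow hfar
  set G := FiniteRank.edgeFn μ𝕋 E ((memLp_two_circle hg).toLp g) with hGdef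
  set a₁ := min a₀ 1 with ha₁
  have ha₁pos : 0 < a₁ := lt_min ha₀ one_pos
  -- g_E at E_max + a₁ is positive: G₀ ≥ k/√a₁
  have hG₀ : 0 < G (Emax + a₁) := by
    have h := hlowb (Emax + a₁) (by linarith) (by rw [add_sub_cancel_left]; exact min_le_left _ _)
    rw [add_sub_cancel_left] at h
    have hs : 0 < Real.sqrt a₁ := Real.sqrt_pos.2 ha₁pos
    by_contra hle
    have : G (Emax + a₁) * Real.sqrt a₁ ≤ 0 := mul_nonpos_of_nonpos_of_nonneg (not_lt.1 hle) hs.le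
    linarith
  have hK : 0 < K := by
    have h := hupb (Emax + a₁) (by linarith) (by rw [add_sub_cancel_left]; exact min_le_right _ _)
    rw [add_sub_cancel_left] at h
    exact lt_of_lt_of_le (mul_pos hG₀ (Real.sqrt_pos.2 ha₁pos)) h
  refine ⟨(G (Emax + a₁))⁻¹, inv_pos.2 hG₀, k ^ 2, by positivity, K ^ 2, by positivity,
    fun lam hlam hlam0 x hx hψ => ?_⟩
  have heq : lam * G x = 1 := (hasEigenvector_circle_iff hE hg hEmax lam hx).1 hψ
  set a := x - Emax with ha_def
  have ha : 0 < a := sub_pos.2 hx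
  -- a ≤ a₁, else antitonicity contradicts λ < λ₀
  have haa₁ : a ≤ a₁ := by
    by_contra h
    have hxle : Emax + a₁ ≤ x := by linarith [not_le.1 h]
    have hanti : G x ≤ G (Emax + a₁) :=
      FiniteRank.edgeFn_antitone hE.measurable hEmax (by linarith) hxle _
    have h1 : 1 ≤ lam * G (Emax + a₁) := heq ▸ mul_le_mul_of_nonneg_left hanti hlam.le
    have h2 : lam * G (Emax + a₁) < 1 := by
      have := mul_lt_mul_of_pos_right hlam0 hG₀
      rwa [inv_mul_cancel₀ hG₀.ne'] at this
    linarith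
  have hGx : G x = lam⁻¹ := by
    field_simp
    linarith [heq]
  have hl := hlowb x hx (haa₁.trans (min_le_left _ _))
  have hu := hupb x hx (haa₁.trans (min_le_right _ _))
  rw [hGx] at hl hu
  have hsq : Real.sqrt a ^ 2 = a := Real.sq_sqrt ha.le
  -- k ≤ √a/λ and √a/λ ≤ K
  have hl' : k * lam ≤ Real.sqrt a := by
    have := mul_le_mul_of_nonneg_right hl hlam.le
    rwa [mul_assoc, mul_comm (Real.sqrt a), ← mul_assoc, inv_mul_cancel₀ hlam.ne', one_mul] at this
  have hu' : Real.sqrt a ≤ K * lam := by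
    have := mul_le_mul_of_nonneg_right hu hlam.le
    rwa [mul_assoc, mul_comm (Real.sqrt a), ← mul_assoc, inv_mul_cancel₀ hlam.ne', one_mul] at this
  constructor
  · calc k ^ 2 * lam ^ 2 = (k * lam) ^ 2 := by ring
      _ ≤ Real.sqrt a ^ 2 := pow_le_pow_left₀ (by positivity) hl' 2
      _ = a := hsq
  · calc a = Real.sqrt a ^ 2 := hsq.symm
      _ ≤ (K * lam) ^ 2 := pow_le_pow_left₀ (Real.sqrt_nonneg _) hu' 2
      _ = K ^ 2 * lam ^ 2 := by ring

end Edge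

end PinnedChainKinetic

end Literature.MathematicalPhysics.KineticTheory.HeatConduction
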